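import Literature.NumberTheory.Automorphic.PairLFunctionPolesEqConjLocalReduction
import Literature.NumberTheory.Automorphic.PairLFunctionPolesRealMoments
import HarnessLib

/-!
# Arthur–Clozel (2.3) from the absolute convergence of the bad-place Rankin–Selberg integral AT `s = 1`

Topic `NumberTheory/Automorphic`; namespace `Literature.NumberTheory.Automorphic`. Proof file (theorems
only: no definition, no named fact, no instance) under the named fact
`JacquetShalika1981_partialPairL_pole_of_eq_conj` (`PairLFunctionPoles`; Arthur–Clozel, *Simple algebras,
base change, and the advanced theory of the trace formula* (1989), Ch. 3 §2 (2.3), p. 171: for unitary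
cuspidal `π ≅ σ̃` "the limit `lim_{s → 1, Re s > 1} (s - 1) L^S(s, π ⊗ σ)` exists and is finite and
non-zero"; "cf. [Jacquet–Shalika II, Prop. 3.6]").

The tree holds the complete GLOBAL half of the printed Rankin–Selberg proof (Jacquet–Shalika I, §4;
Cogdell (2004), §2.3, Thm. 2.2, §4.2) for every `n ≥ 1`: residue of the global integral
(`RankinSelbergResidueDatum`), unfolding on the strip `1 < Re s < 2` (`RankinSelbergUnfoldingIdentity`),
exact Euler factorisation `Ψ(s; W_φ, W̄_φ, Φ) = L^{S'}(s, β ⊗ β̄) · Ψ_{S'}(s)` (`RankinSelbergUnfoldedEulerCuspidal`),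
change of `S` (`PairLFunctionPolesEqConjOneFamily`) and the strict bound `|a| < q_v^{1/2}`
(`norm_satakeParameter_lt_sqrt_of_isGeneric`). Two assemblies exist: the complex one,
`JacquetShalika1981_partialPairL_pole_of_eq_conj_of_local_rankinSelberg` (`PairLFunctionPolesEqConjLocalReduction`,
hypothesis: a non-zero LIMIT of `Ψ_{S'}(s)` at `1` for EVERY datum — as quantified there, also over the
zero vector, that hypothesis cannot be met), and the real-moment one,
`JacquetShalika1981_partialPairL_pole_of_eq_conj_of_real_moment_datum` (`PairLFunctionPolesEqConjRealMomentsOneFamily`,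
hypothesis: an abstract real-moment datum per cuspidal representation).

This file closes the gap between them and states what is left of (2.3) in final form:

* `torusWeightC_eq_torusWeight_zero_mul_cpow`, `torusIntegrandC_eq_ofReal_mul_cpow` — the complex torus
  integrand IS a moment integrand `G · w^s` with `G = |W|² Φ δ_B⁻¹ ≥ 0` and `w = |det a| > 0`
  (`torusWeight_eq_torusWeight_zero_mul_rpow` at real points);
* `JacquetShalika1981_partialPairL_pole_of_eq_conj_of_firstMoment` (**main**) — **the named fact, in
  every rank, follows from ONE true local statement: for every cuspidal `Π` there are `f ∈ Π` and a test
  function `η` with `S_η f ≠ 0` such that for every finite set `S'` of finite places and all Haar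
  measures the `S'`-part of the unfolded integral of the datum `(W_{S_η f}, Φ_∞^{Gauss} ⊗ 𝟙_{𝒪̂ⁿ})`
  converges AT the real point `s = 1`**:
  `∫⁻_{B({v ∉ S'}) × K} |W_φ(diag(a) k)|² Φ(e_n diag(a) k) |det a| δ_B(a)⁻¹ < ∞`
  (Jacquet–Shalika I, §1 and §3 — Prop. (3.17): the local integrals `Ψ(s, W, W', Φ)` of the components
  of cuspidal representations "converge absolutely in the half plane `Re(s) ≥ 1`"; Cogdell (2004),
  Thm. 3.2 (1), p. 192). Nothing else local is needed: no continuity in `s`, no non-vanishing, no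
  complex `s` — these are supplied by the moment lemma
  `exists_ne_zero_tendsto_sub_one_mul_of_integral_mul_cpow` (`PairLFunctionPolesRealMoments`: domination
  by `G (w + w²)` on `1 ≤ Re s ≤ 2`, the second moment being finite GLOBALLY by
  `rankinSelbergTorusIntegral_whittakerCoeff_ne_top_of_mem_piSchwartzBruhat` at `σ = 2`, and the
  automatic non-vanishing of the first moment from the residue `r ≠ 0`);
* `JacquetShalika1981_partialPairL_pole_of_eq_conj_of_forall_firstMoment` — the same from the universally
  quantified (still true) form of the hypothesis, the test datum being supplied by
  `CuspidalAutomorphicRepGL.exists_isTestFunctionGL_smoothedForm_ne_zero`.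

In rank `n = 1` the hypothesis is not needed (`PairLFunctionPolesGLOneDedekindProofs`); in ranks `n ≥ 2`
it is the square-integrability near the walls `a_i/a_{i+1} → 0` (at the places of `S' ∪ S_∞`) of the
Whittaker functions of unitary generic representations, i.e. the local theory of Jacquet–Shalika I, §§1, 3.

## References

* J. Arthur, L. Clozel, *Simple algebras, base change, and the advanced theory of the trace formula*,
  Ann. of Math. Stud. 120 (1989), Ch. 3 §2, (2.3), p. 171 [ArthurClozelAMS120].
* H. Jacquet, J. A. Shalika, *On Euler products and the classification of automorphic representations
  I*, Amer. J. Math. 103 (1981), 499–558, §1, §3 (Prop. (3.17)), §4 [JacquetShalikaAJM1981]; *II*,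
  ibid. 777–815, §3, Prop. 3.6 [JacquetShalikaAJM1981II].
* J. W. Cogdell, *Analytic theory of L-functions for GL_n*, in *An Introduction to the Langlands Program*
  (2004), §2.3 Thm. 2.2, §3 Thm. 3.2 (1) (p. 192), §4.2 [CogdellAnalyticTheory2004].
-/

noncomputable section

open MeasureTheory Measure NumberField IsDedekindDomain Matrix Set Filter Finset Topology
open scoped MatrixGroups ENNReal NNReal Pointwise ValuativeRel ComplexConjugate
open Literature.RingTheory.SymmetricFunctions.SymmPoly
open Literature.NumberTheory.GaloisRepresentations (ideleGroup)

namespace Literature.NumberTheory.Automorphic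

-- the automorphic quotient carries the tree's Borel σ-algebra, not Mathlib's quotient σ-algebra
attribute [-instance] Quotient.instMeasurableSpace QuotientGroup.measurableSpace

/-! ### The torus integrand as a moment integrand `G · w^s` -/

section Moment

variable {n : ℕ} {K : Type} [Field K] [NumberField K]

/-- The positive real `|det a| = ∏ᵢ ‖aᵢ‖` of a torus element. [folklore] -/
theorem prod_ideleNorm_pos (a : Fin n → ideleGroup K) :
    0 < ∏ i : Fin n, ((IdeleClassGroup.ideleNorm K (a i) : ℝ≥0) : ℝ) :=
  Finset.prod_pos fun i _ => ideleNorm_coe_pos K (a i)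

/-- **`|det a|^σ δ_B(a)⁻¹ = δ_B(a)⁻¹ · |det a|^σ`**: the real torus weight at `σ` is the weight at `0`
times the `σ`-th power of `|det a| = ∏ᵢ ‖aᵢ‖`. [folklore] -/
theorem torusWeight_eq_torusWeight_zero_mul_rpow (σ : ℝ) (a : Fin n → ideleGroup K) :
    torusWeight n K σ a =
      torusWeight n K 0 a * (∏ i : Fin n, ((IdeleClassGroup.ideleNorm K (a i) : ℝ≥0) : ℝ)) ^ σ := by
  unfold torusWeight
  rw [← Real.finsetProd_rpow _ _ (fun i _ => (ideleNorm_coe_pos K (a i)).le), ← Finset.prod_mul_distrib]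
  refine Finset.prod_congr rfl fun i _ => ?_
  rw [← Real.rpow_add (ideleNorm_coe_pos K (a i))]
  congr 1
  ring

/-- `∏ᵢ (xᵢ : ℂ)^s = (∏ᵢ xᵢ : ℂ)^s` for non-negative reals `xᵢ` (principal powers). [folklore] -/
theorem prod_ofReal_cpow_eq {ι : Type*} (t : Finset ι) {x : ι → ℝ} (hx : ∀ i ∈ t, 0 ≤ x i) (s : ℂ) :
    ∏ i ∈ t, ((x i : ℝ) : ℂ) ^ s = (((∏ i ∈ t, x i : ℝ)) : ℂ) ^ s := by
  classical
  induction t using Finset.induction_on with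
  | empty => simp
  | @insert j t hj ih =>
    rw [Finset.prod_insert hj, Finset.prod_insert hj, ih (fun i hi => hx i (Finset.mem_insert_of_mem hi)),
      Complex.ofReal_mul, Complex.mul_cpow_ofReal_nonneg (hx j (Finset.mem_insert_self j t))
        (Finset.prod_nonneg fun i hi => hx i (Finset.mem_insert_of_mem hi))]

/-- **The complex torus weight is `δ_B(a)⁻¹ · |det a|^s`**:
`torusWeightC s a = torusWeight 0 a · (∏ᵢ ‖aᵢ‖)^s`. [folklore] -/
theorem torusWeightC_eq_torusWeight_zero_mul_cpow (s : ℂ) (a : Fin n → ideleGroup K) :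
    torusWeightC n K s a =
      ((torusWeight n K 0 a : ℝ) : ℂ) *
        (((∏ i : Fin n, ((IdeleClassGroup.ideleNorm K (a i) : ℝ≥0) : ℝ) : ℝ)) : ℂ) ^ s := by
  unfold torusWeightC torusWeight
  rw [Complex.ofReal_prod, ← prod_ofReal_cpow_eq _ (fun i _ => (ideleNorm_coe_pos K (a i)).le),
    ← Finset.prod_mul_distrib]
  refine Finset.prod_congr rfl fun i _ => ?_
  have hx : 0 < ((IdeleClassGroup.ideleNorm K (a i) : ℝ≥0) : ℝ) := ideleNorm_coe_pos K (a i)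
  have hx0 : (((IdeleClassGroup.ideleNorm K (a i) : ℝ≥0) : ℝ) : ℂ) ≠ 0 := by exact_mod_cast hx.ne'
  rw [sub_eq_neg_add, Complex.cpow_add _ _ hx0, Complex.ofReal_cpow hx.le]
  congr 2
  push_cast
  ring

variable {W : GL (Fin n) (AdeleRing (𝓞 K) K) → ℂ} {Φ : (Fin n → AdeleRing (𝓞 K) K) → ℝ}

/-- **The complex torus integrand is a moment integrand**: with
`G(a, k) = |W(diag(a) k)|² Φ(e_n diag(a) k) δ_B(a)⁻¹` and `w(a, k) = |det a| = ∏ᵢ ‖aᵢ‖`,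
`torusIntegrandC s (a, k) = G(a, k) · w(a, k)^s`. [folklore] -/
theorem torusIntegrandC_eq_ofReal_mul_cpow (s : ℂ) (p : (Fin n → ideleGroup K) × ↥(maximalCompactAdelic n K)) :
    torusIntegrandC n K W Φ s p =
      ((‖W (torusPoint n K p)‖ ^ 2 * Φ (lastRow n K (torusPoint n K p)) * torusWeight n K 0 p.1 : ℝ) : ℂ) *
        (((∏ i : Fin n, ((IdeleClassGroup.ideleNorm K (p.1 i) : ℝ≥0) : ℝ) : ℝ)) : ℂ) ^ s := by
  rw [torusIntegrandC, torusWeightC_eq_torusWeight_zero_mul_cpow, ← mul_assoc, ← Complex.ofReal_mul]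

/-- **The real torus integrand is the real moment integrand**:
`torusIntegrand σ (a, k) = ofReal (G(a, k) · w(a, k)^σ)`. [folklore] -/
theorem torusIntegrand_eq_ofReal_mul_rpow (σ : ℝ) (p : (Fin n → ideleGroup K) × ↥(maximalCompactAdelic n K)) :
    torusIntegrand n K W Φ σ p =
      ENNReal.ofReal (‖W (torusPoint n K p)‖ ^ 2 * Φ (lastRow n K (torusPoint n K p)) * torusWeight n K 0 p.1 *
        (∏ i : Fin n, ((IdeleClassGroup.ideleNorm K (p.1 i) : ℝ≥0) : ℝ)) ^ σ) := by
  rw [torusIntegrand, torusWeight_eq_torusWeight_zero_mul_rpow σ p.1, ← mul_assoc]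

end Moment

/-! ### (2.3) from the first moment -/

section FirstMoment

variable {n : ℕ} {K : Type} [Field K] [NumberField K]
variable {μ' : Measure (AdelicGroupData.gl n K).automorphicQuotient}
  [(AdelicGroupData.gl n K).IsAutomorphicMeasure μ']

-- the house local instances: Borel structures of `GL_n(𝔸_K)` in both spellings; none overrides a
-- Mathlib instance
attribute [local instance] adelicBorel borelSpace_adelic locallyCompactSpace_adelic secondCountableTopology_gl_adelic
  glAdeleBorel borelSpace_glAdele

/-- **Arthur–Clozel (2.3) from the absolute convergence of the bad-place integral at `s = 1`.** Suppose that
for every cuspidal automorphic representation `Π` of `GL_n(𝔸_K)` there are `f ∈ Π` and a test function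
`η` with `S_η f ≠ 0` such that, for every finite set `S'` of finite places and all Haar measures, the
`S'`-part of the unfolded Rankin–Selberg integral of the datum `(W_{S_η f}, Φ_∞^{Gauss} ⊗ 𝟙_{𝒪̂ⁿ})` is
finite AT the real point `s = 1`:
`∫⁻_{B({v ∉ S'}) × K} |W_φ(diag(a) k)|² Φ(e_n diag(a) k) |det a| δ_B(a)⁻¹ d(νA × νK) < ∞`
(Jacquet–Shalika I, Prop. (3.17) with §1: the local Rankin–Selberg integrals of the components of
cuspidal representations converge absolutely for `Re s ≥ 1`; Cogdell (2004), Thm. 3.2 (1)). Then the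
named fact `JacquetShalika1981_partialPairL_pole_of_eq_conj` holds in rank `n` over `K`: for unitary
cuspidal `π ≅ σ̃`, every finite `S` and all Satake families off `S`, `(s - 1) L^S(s, π ⊗ σ)` has a finite
non-zero limit as `s → 1`, `Re s > 1`. Proof: for `Π = σ` run the global method of the tree on the given
datum — residue `(s - 1) I(s) → r ≠ 0` (`exists_residue_datum`), unfolding `I = C Ψ` on `1 < Re s < 2`
(`exists_rankinSelbergIntegral_eq_mul_rankinSelbergTorusIntegralC`), Euler factorisation
`Ψ = L^{S'} · Ψ_{S'}` on `Re s > 1` (`rankinSelbergTorusIntegralC_whittakerCoeff_eq_partialPairL_mul`) for a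
finite `S'` containing the ramified places, the level, the ramification of `ψ` and the support of a
non-vanishing torus point — write `Ψ_{S'}(s) = ∫ G w^s` (`torusIntegrandC_eq_ofReal_mul_cpow`), note that
the second moment `∫ G w²` is finite globally (`rankinSelbergTorusIntegral_whittakerCoeff_ne_top_of_mem_piSchwartzBruhat`
at `σ = 2`) and the first by hypothesis, and conclude by
`exists_ne_zero_tendsto_sub_one_mul_of_integral_mul_cpow` and the change of `S`
(`JacquetShalika1981_partialPairL_pole_of_eq_conj_of_one_family'`, strict bound from
`norm_satakeParameter_lt_sqrt_of_isGeneric`).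
[cite: ArthurClozelAMS120, Ch. 3 §2 (2.3)] [cite: JacquetShalikaAJM1981, §1, Prop. (3.17), §4; II Prop. 3.6]
[cite: CogdellAnalyticTheory2004, Thm. 3.2 (1), §4.2] -/
theorem JacquetShalika1981_partialPairL_pole_of_eq_conj_of_firstMoment
    (hfin : ∀ [MeasurableSpace (AdeleRing (𝓞 K) K)] [BorelSpace (AdeleRing (𝓞 K) K)]
      (P : CuspidalAutomorphicRepGL n K μ'),
      ∃ (f : P.1.toSubmodule) (η : (AdelicGroupData.gl n K).Adelic → ℝ), IsTestFunctionGL n K η ∧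
        smoothedForm η (f : (AdelicGroupData.gl n K).L2 μ') ≠ 0 ∧
        ∀ (S' : Set (HeightOneSpectrum (𝓞 K))), S'.Finite →
          ∀ (νA : Measure (Fin n → ideleGroup K)) (_ : IsHaarMeasure νA)
            (νK : Measure ↥(maximalCompactAdelic n K)) (_ : IsHaarMeasure νK)
            (ν₀ : Measure ↥(adelicUnipotent n K)) (_ : IsHaarMeasure ν₀),
            ∫⁻ p in unitBox {v | v ∉ S'} ×ˢ Set.univ, torusIntegrand n K
                (whittakerCoeff ν₀ (unipotentTateDomain n K) (adeleAddChar K)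
                  (invQuot (AdelicGroupData.gl n K) (smoothedForm η (f : (AdelicGroupData.gl n K).L2 μ'))))
                (standardTestFun n K (gaussArchTestFun n K)) 1 p ∂(νA.prod νK) ≠ ⊤) :
    JacquetShalika1981_partialPairL_pole_of_eq_conj (n := n) (K := K) (μ := μ') := by
  refine JacquetShalika1981_partialPairL_pole_of_eq_conj_of_one_family'
    JacquetShalika1981_multipliable_partialPairL_holds
    (fun P _ _ hα _ hv _ ha => norm_satakeParameter_lt_sqrt_of_isGeneric
      exists_hasLocalComponentAt_holds Flath1979_isSatakeParameter_of_hasLocalComponentAt_holds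
      Shalika1974_isGeneric_of_hasLocalComponentAt_holds
      (fun _ _ _ _ _ => JacquetShalika1981_norm_lt_sqrt_of_isGeneric_holds) P hα hv ha) fun hn P => ?_
  classical
  -- topological and measurable structures
  haveI : T2Space (GL (Fin n) (AdeleRing (𝓞 K) K)) := t2Space_gl n K
  haveI : LocallyCompactSpace (GL (Fin n) (AdeleRing (𝓞 K) K)) :=
    AdelicGroupData.locallyCompactSpace_generalLinearGroup_adeleRing K (Fin n)
  haveI := secondCountableTopology_generalLinearGroup_adeleRing K (Fin n)
  haveI : T2Space (AdeleRing (𝓞 K) K) := t2Space_adeleRing K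
  letI : MeasurableSpace (AdeleRing (𝓞 K) K) := borel _
  haveI : BorelSpace (AdeleRing (𝓞 K) K) := ⟨rfl⟩
  haveI := borelSpace_ideleGroup K
  haveI := locallyCompactSpace_ideleGroup K
  haveI := secondCountableTopology_ideleGroup K
  haveI := secondCountableTopology_adeleRing K
  haveI := locallyCompactSpace_adeleRing' K
  haveI : CompactSpace ↥(maximalCompactAdelic n K) :=
    isCompact_iff_compactSpace.1 (isCompact_maximalCompactAdelic n K)
  haveI : LocallyCompactSpace ↥(adelicUnipotent n K) := (isClosed_adelicUnipotent n K).locallyCompactSpace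
  haveI : SecondCountableTopology (AdelicGroupData.gl n K).Adelic :=
    secondCountableTopology_generalLinearGroup_adeleRing K (Fin n)
  haveI : SecondCountableTopology ↥(maximalCompactAdelic n K) := TopologicalSpace.Subtype.secondCountableTopology _
  -- Haar measures
  obtain ⟨νI, hνI⟩ := exists_isHaarMeasure_ideleGroup K
  haveI hνIR : νI.IsMulRightInvariant := by
    haveI := isInvInvariant_of_isHaarMeasure_ideleGroup (K := K) νI
    infer_instance
  set μ : Measure (Fin n → AdeleRing (𝓞 K) K) := Measure.addHaar with hμ
  set νA : Measure (Fin n → ideleGroup K) := Measure.haar with hνA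
  set νK : Measure ↥(maximalCompactAdelic n K) := Measure.haar with hνK
  set ν₀ : Measure ↥(adelicUnipotent n K) := Measure.haar with hν₀
  haveI hν₀R : ν₀.IsMulRightInvariant := isMulRightInvariant_of_isHaarMeasure_adelicUnipotent ν₀
  -- (1) a Satake family and the test datum of the hypothesis, with its level
  obtain ⟨S₁, β₀, -, hβ₀⟩ := exists_isSatakeFamilyOf_holds (n := n) (K := K) (μ := μ') P
  obtain ⟨f, η, hη, hne, hfirst⟩ := hfin P
  obtain ⟨𝔫₀, h𝔫₀, hηK⟩ := hη.exists_forall_mul_left_eq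
  have hηc : Continuous η := hη.continuous
  have hηs : HasCompactSupport η := hη.hasCompactSupport
  have hcusp : ((f : P.1.toSubmodule) : (AdelicGroupData.gl n K).L2 μ') ∈ cuspidalSubspace n K μ' :=
    P.le_cuspidalSubspace f.2
  -- (2) the Whittaker coefficient: continuity, a non-vanishing torus point with integral last entry
  have hψ : IsGlobalAddChar K (adeleAddChar K) := isGlobalAddChar_adeleAddChar (K := K)
  have h𝓕 : IsFundamentalDomain ↥(rationalUnipotent n K) (unipotentTateDomain n K) ν₀ :=
    isFundamentalDomain_unipotentTateDomain ν₀
  have h𝓕c : IsCompact (closure (unipotentTateDomain n K)) := isCompact_closure_unipotentTateDomain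
  have h𝓕m : MeasurableSet (unipotentTateDomain n K) := measurableSet_unipotentTateDomain
  set φ : GL (Fin n) (AdeleRing (𝓞 K) K) → ℂ :=
    invQuot (AdelicGroupData.gl n K) (smoothedForm η ((f : P.1.toSubmodule) : (AdelicGroupData.gl n K).L2 μ'))
    with hφ
  have hφc : Continuous φ := continuous_invQuot_smoothedForm hηc hηs _
  have hφinv : IsLeftInvariant (AdelicGroupData.gl n K) φ := isLeftInvariant_invQuot _ _
  set W : GL (Fin n) (AdeleRing (𝓞 K) K) → ℂ :=
    whittakerCoeff ν₀ (unipotentTateDomain n K) (adeleAddChar K) φ with hW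
  have hWc : Continuous W := continuous_whittakerCoeff h𝓕m h𝓕c hψ.continuous hφc
  have hWN : ∀ u ∈ upperUnitriangular (Fin n) (AdeleRing (𝓞 K) K), ∀ g, ‖W (u * g)‖ = ‖W g‖ := by
    intro u hu g
    have h := whittakerCoeff_unipotent_mul (ν := ν₀) (𝓕 := unipotentTateDomain n K)
      (ψ := adeleAddChar K) h𝓕 hψ hφinv ⟨u, hu⟩ g
    change W (u * g) = _ * W g at h
    rw [h, norm_mul, whittakerCharFun_apply, Circle.norm_coe, one_mul]
  obtain ⟨g₁, hg₁⟩ := exists_whittakerCoeff_invQuot_smoothedForm_ne_zero_of_one_le hn hηc hηs hcusp hne ν₀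
  obtain ⟨a₁, k₀, ha₁⟩ := exists_torusPoint_apply_ne_zero hWN hg₁
  obtain ⟨d, hd0, hdint⟩ := exists_ne_zero_valued_algebraMap_mul_le_one (K := K) (lastEntry a₁)
  have hdK : (d : K) ≠ 0 := RingOfIntegers.coe_ne_zero_iff.mpr hd0
  set c : Kˣ := Units.mk0 (d : K) hdK with hc
  set ξ : ideleGroup K := Units.map (algebraMap K (AdeleRing (𝓞 K) K) : K →* AdeleRing (𝓞 K) K) c
    with hξ
  have hξval : ((ξ : ideleGroup K) : AdeleRing (𝓞 K) K) = algebraMap K (AdeleRing (𝓞 K) K) (d : K) := by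
    rw [hξ, Units.coe_map, hc, Units.val_mk0]
    rfl
  set a₀ : Fin n → ideleGroup K := (fun _ => ξ) * a₁ with ha₀
  have ha₀W : W (torusPoint n K (a₀, k₀)) ≠ 0 := by
    have e : W (torusPoint n K (a₀, k₀)) = W (torusPoint n K (a₁, k₀)) := by
      rw [ha₀, torusPoint_mul, hW, hξ]
      exact whittakerCoeff_glDiagonal_const_mul ν₀ _ _ hφinv c _
    rw [e]
    exact ha₁
  have hlast : lastEntry a₀ = ξ * lastEntry a₁ := by
    rw [ha₀, lastEntry_mul]
    congr 1
    unfold lastEntry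
    rw [dif_pos (by omega : 0 < n)]
  have hint : ∀ w : HeightOneSpectrum (𝓞 K),
      Valued.v (((lastEntry a₀ : ideleGroup K) : AdeleRing (𝓞 K) K).2 w) ≤ 1 := by
    intro w
    rw [hlast, Units.val_mul, hξval]
    exact hdint w
  -- (3) the exceptional finite set `S'` and the good places
  obtain ⟨Sψ, hSψ⟩ := exists_finset_adicComponent_adeleAddChar_unramified (K := K)
  set S₀ : Finset (HeightOneSpectrum (𝓞 K)) :=
    S₁ ∪ (Ideal.finite_factors h𝔫₀).toFinset ∪ Sψ ∪ (finite_setOf_exists_valued_ne_one a₀).toFinset with hS₀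
  set S' : Set (HeightOneSpectrum (𝓞 K)) := ↑S₀ with hS'
  have hS'fin : S'.Finite := S₀.finite_toSet
  have hS₁S' : (↑S₁ : Set (HeightOneSpectrum (𝓞 K))) ⊆ S' := by
    intro v hv
    simp only [hS', hS₀, Finset.coe_union, Set.mem_union, Finset.mem_coe] at hv ⊢
    exact Or.inl (Or.inl (Or.inl hv))
  have hgood : ∀ v ∉ S', ¬ v.asIdeal ∣ 𝔫₀ ∧ v ∉ Sψ ∧
      ∀ i, Valued.v (((a₀ i : ideleGroup K) : AdeleRing (𝓞 K) K).2 v) = 1 := by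
    intro v hv
    have hv0 : v ∉ S₀ := fun h => hv h
    simp only [hS₀, Finset.mem_union, Set.Finite.mem_toFinset, Set.mem_setOf_eq, not_or,
      not_exists, ne_eq, not_not] at hv0
    exact ⟨hv0.1.1.2, hv0.1.2, hv0.2⟩
  have hGood : ∀ v ∉ S', ¬ v.asIdeal ∣ 𝔫₀ ∧
      (∀ c ∈ 𝒪[v.adicCompletion K], (adeleAddChar K).adicComponent v c = 1) ∧
      ∀ ϖ : v.adicCompletion K, Valued.v ϖ = WithZero.exp (-1 : ℤ) →
        ∃ c ∈ 𝒪[v.adicCompletion K], (adeleAddChar K).adicComponent v (ϖ⁻¹ * c) ≠ 1 := by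
    intro v hv
    obtain ⟨h1, h2, -⟩ := hgood v hv
    exact ⟨h1, (hSψ v h2).1, (hSψ v h2).2⟩
  have ha₀unit : a₀ ∈ unitBox {v : HeightOneSpectrum (𝓞 K) | v ∉ S'} := fun v hv i => (hgood v hv).2.2 i
  -- enumerations of the Satake parameters off `S'`
  have hβ₀' : IsSatakeFamilyOf P S' β₀ := hβ₀.mono hS₁S'
  have hex : ∀ v : HeightOneSpectrum (𝓞 K), ∃ x : Fin n → ℂ,
      v ∉ S' → (Finset.univ : Finset (Fin n)).val.map x = β₀ v := by
    intro v
    by_cases hv : v ∉ S'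
    · obtain ⟨x, hx⟩ := exists_univ_val_map_eq (hβ₀'.card_eq hv)
      exact ⟨x, fun _ => hx⟩
    · exact ⟨fun _ => 0, fun h => absurd h hv⟩
  choose x hx using hex
  -- (4) the Gaussian test function
  set Φ : (Fin n → AdeleRing (𝓞 K) K) → ℝ := standardTestFun n K (gaussArchTestFun n K) with hΦ
  have hΦS : (fun y => (Φ y : ℂ)) ∈ piSchwartzBruhat K (Fin n) := standardTestFun_gauss_mem_piSchwartzBruhat n K
  have hΦ0 : ∀ y, 0 ≤ Φ y := standardTestFun_gauss_nonneg n K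
  have hΦc : Continuous Φ := continuous_standardTestFun_of_continuous n K (continuous_gaussArchTestFun n K)
  have hΦm : Measurable fun g : GL (Fin n) (AdeleRing (𝓞 K) K) => Φ (lastRow n K g) :=
    (hΦc.comp continuous_lastRow).measurable
  -- (5) the residue: `(s - 1) I(s) → r ≠ 0`
  obtain ⟨-, r, -, hr, hI⟩ := P.exists_residue_datum hn νI μ hΦS
    (integral_ofReal_standardTestFun_gauss_ne_zero n K μ) hη f hne
  -- (6) the unfolding identity on the strip
  obtain ⟨C, hC, hunf⟩ :=
    exists_rankinSelbergIntegral_eq_mul_rankinSelbergTorusIntegralC (n := n) (K := K) hn μ' νI νA νK ν₀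
  -- (7) the Euler factorisation on `Re s > 1`
  have hEuler : ∀ s : ℂ, 1 < s.re →
      rankinSelbergTorusIntegralC n K νA νK W Φ s =
        partialPairL S' β₀ (conjFamily β₀) s *
          ∫ p in unitBox {v | v ∉ S'} ×ˢ Set.univ, torusIntegrandC n K W Φ s p ∂(νA.prod νK) := by
    intro s hs
    have hfin' : rankinSelbergTorusIntegral n K νA νK W Φ s.re ≠ ⊤ :=
      rankinSelbergTorusIntegral_whittakerCoeff_ne_top_of_mem_piSchwartzBruhat hn νA νK ν₀ P f hη hΦS hΦ0 hΦm hs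
    have hpos := setLIntegral_torusIntegrand_unitBox_ne_zero hWc ha₀W ha₀unit hint
      (continuous_gaussArchTestFun n K) (gaussArchTestFun_pos n K) s.re νA νK
    exact rankinSelbergTorusIntegralC_whittakerCoeff_eq_partialPairL_mul hn P hβ₀ h𝔫₀ hηc hηs hηK f h𝓕 h𝓕m
      h𝓕c hψ hS₁S' hGood (fun v hv => hx v hv) (fun z => (gaussArchTestFun_pos n K z).le) hΦm νA νK hs hfin' hpos
  -- (8) the `S'`-part as a moment `∫ G w^s dm` over the restricted measure
  set X := (Fin n → ideleGroup K) × ↥(maximalCompactAdelic n K)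
  set m : Measure X := (νA.prod νK).restrict (unitBox {v | v ∉ S'} ×ˢ Set.univ) with hm
  set G : X → ℝ := fun p =>
    ‖W (torusPoint n K p)‖ ^ 2 * Φ (lastRow n K (torusPoint n K p)) * torusWeight n K 0 p.1 with hG
  set w : X → ℝ := fun p => ∏ i : Fin n, ((IdeleClassGroup.ideleNorm K (p.1 i) : ℝ≥0) : ℝ) with hw
  have hpt : Measurable (torusPoint n K) := continuous_torusPoint.measurable
  have hGm : Measurable G :=
    (((hWc.measurable.comp hpt).norm.pow_const 2).mul (hΦm.comp hpt)).mul
      ((continuous_torusWeight 0).measurable.comp measurable_fst)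
  have hwm : Measurable w := by
    refine Finset.measurable_prod _ fun i _ => ?_
    exact measurable_coe_nnreal_real.comp
      ((continuous_ideleNorm_holds K).measurable.comp ((measurable_pi_apply i).comp measurable_fst))
  have hG0 : ∀ p, 0 ≤ G p := fun p =>
    mul_nonneg (mul_nonneg (sq_nonneg _) (hΦ0 _)) (torusWeight_nonneg 0 p.1)
  have hw0 : ∀ p, 0 < w p := fun p => prod_ideleNorm_pos p.1
  -- real moments are the real torus integrals over the unit box
  have hmom : ∀ σ : ℝ, ∫⁻ p, ENNReal.ofReal (G p * w p ^ σ) ∂m =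
      ∫⁻ p in unitBox {v | v ∉ S'} ×ˢ Set.univ, torusIntegrand n K W Φ σ p ∂(νA.prod νK) := by
    intro σ
    refine lintegral_congr fun p => ?_
    rw [torusIntegrand_eq_ofReal_mul_rpow]
  have hintegrable : ∀ σ : ℝ,
      ∫⁻ p in unitBox {v | v ∉ S'} ×ˢ Set.univ, torusIntegrand n K W Φ σ p ∂(νA.prod νK) ≠ ⊤ →
        Integrable (fun p => G p * w p ^ σ) m := by
    intro σ hσ
    refine ⟨(hGm.mul (hwm.pow_const σ)).aestronglyMeasurable, ?_⟩
    rw [hasFiniteIntegral_iff_ofReal (Eventually.of_forall fun p =>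
      mul_nonneg (hG0 p) (Real.rpow_nonneg (hw0 p).le σ)), hmom σ]
    exact lt_top_iff_ne_top.2 hσ
  -- first moment: the hypothesis; second moment: the global finiteness at `σ = 2`
  have h1 : Integrable (fun p => G p * w p) m := by
    have h := hintegrable 1 (hfirst S' hS'fin νA inferInstance νK inferInstance ν₀ inferInstance)
    refine h.congr (Eventually.of_forall fun p => ?_)
    simp only [Real.rpow_one]
  have h2 : Integrable (fun p => G p * w p ^ (2 : ℝ)) m := by
    refine hintegrable 2 (ne_top_of_le_ne_top ?_ (setLIntegral_le_lintegral _ _))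
    have h := rankinSelbergTorusIntegral_whittakerCoeff_ne_top_of_mem_piSchwartzBruhat hn νA νK ν₀ P f hη hΦS
      hΦ0 hΦm (σ := 2) (by norm_num)
    exact h
  -- the identity `I(s) = C · (∫ G w^s dm) · L^{S'}(s)` on the strip
  have hstrip : ∀ᶠ s in 𝓝[{s : ℂ | 1 < s.re}] 1, 1 < s.re ∧ s.re < 2 := by
    have h2' : ∀ᶠ s in 𝓝 (1 : ℂ), s.re < 2 :=
      (Complex.continuous_re.tendsto (1 : ℂ)).eventually (eventually_lt_nhds (by norm_num))
    exact eventually_mem_nhdsWithin.and (eventually_nhdsWithin_of_eventually_nhds h2')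
  have hid : ∀ᶠ s in 𝓝[{s : ℂ | 1 < s.re}] 1,
      rankinSelbergIntegral μ' νI (fun y => (Φ y : ℂ)) s
          (star (smoothedForm η ((f : P.1.toSubmodule) : (AdelicGroupData.gl n K).L2 μ')))
          (smoothedForm η ((f : P.1.toSubmodule) : (AdelicGroupData.gl n K).L2 μ')) =
        (C : ℂ) * (∫ p, (G p : ℂ) * (w p : ℂ) ^ s ∂m) * partialPairL S' β₀ (conjFamily β₀) s := by
    filter_upwards [hstrip] with s hs
    have hset : (∫ p in unitBox {v | v ∉ S'} ×ˢ Set.univ, torusIntegrandC n K W Φ s p ∂(νA.prod νK)) =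
        ∫ p, (G p : ℂ) * (w p : ℂ) ^ s ∂m := by
      rw [hm]
      exact integral_congr_ae (Eventually.of_forall fun p => torusIntegrandC_eq_ofReal_mul_cpow s p)
    rw [hunf P f hη hΦS hΦ0 hΦm hs.1 hs.2, hEuler s hs.1, hset]
    ring
  -- (9) the moment lemma
  refine ⟨S', β₀, hS'fin, hβ₀', ?_⟩
  exact exists_ne_zero_tendsto_sub_one_mul_of_integral_mul_cpow hr (Complex.ofReal_ne_zero.2 hC.ne') hI
    hGm hwm hG0 hw0 h1 h2 hid

/-- **Arthur–Clozel (2.3) from the absolute convergence at `s = 1` for all data** (the universally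
quantified, still true, form of the hypothesis of
`JacquetShalika1981_partialPairL_pole_of_eq_conj_of_firstMoment`: for EVERY `f ∈ Π` and every test
function `η`, the `S'`-parts of the unfolded integral of `(W_{S_η f}, Φ^{Gauss})` converge at `s = 1` —
Jacquet–Shalika I, §1 and Prop. (3.17); Cogdell (2004), Thm. 3.2 (1)); the non-zero test datum is
supplied by `CuspidalAutomorphicRepGL.exists_isTestFunctionGL_smoothedForm_ne_zero`.
[cite: ArthurClozelAMS120, Ch. 3 §2 (2.3)] [cite: JacquetShalikaAJM1981, §1, Prop. (3.17); II Prop. 3.6] -/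
theorem JacquetShalika1981_partialPairL_pole_of_eq_conj_of_forall_firstMoment
    (hfin : ∀ [MeasurableSpace (AdeleRing (𝓞 K) K)] [BorelSpace (AdeleRing (𝓞 K) K)]
      (P : CuspidalAutomorphicRepGL n K μ') (f : P.1.toSubmodule)
      (η : (AdelicGroupData.gl n K).Adelic → ℝ) (_hη : IsTestFunctionGL n K η)
      (S' : Set (HeightOneSpectrum (𝓞 K))) (_hS' : S'.Finite)
      (νA : Measure (Fin n → ideleGroup K)) (_ : IsHaarMeasure νA)
      (νK : Measure ↥(maximalCompactAdelic n K)) (_ : IsHaarMeasure νK)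
      (ν₀ : Measure ↥(adelicUnipotent n K)) (_ : IsHaarMeasure ν₀),
      ∫⁻ p in unitBox {v | v ∉ S'} ×ˢ Set.univ, torusIntegrand n K
          (whittakerCoeff ν₀ (unipotentTateDomain n K) (adeleAddChar K)
            (invQuot (AdelicGroupData.gl n K) (smoothedForm η (f : (AdelicGroupData.gl n K).L2 μ'))))
          (standardTestFun n K (gaussArchTestFun n K)) 1 p ∂(νA.prod νK) ≠ ⊤) :
    JacquetShalika1981_partialPairL_pole_of_eq_conj (n := n) (K := K) (μ := μ') := by
  refine JacquetShalika1981_partialPairL_pole_of_eq_conj_of_firstMoment fun P => ?_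
  obtain ⟨f, η, hη, -, hne, -⟩ := P.exists_isTestFunctionGL_smoothedForm_ne_zero
  exact ⟨f, η, hη, hne, fun S' hS' νA hνA νK hνK ν₀ hν₀ => hfin P f η hη S' hS' νA hνA νK hνK ν₀ hν₀⟩

end FirstMoment

end Literature.NumberTheory.Automorphic
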